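import Summits.AtomisticToContinuum.BoseEinsteinCondensation.Theses.BECThomsonPrinciple
import Literature.MathematicalPhysics.QuantumManyBody.WeightedCorrector
import Literature.MathematicalPhysics.QuantumManyBody.PeriodicBoseGasFourier
import Literature.MathematicalPhysics.QuantumManyBody.PeriodicBoseGasScatteringSolution
import HarnessLib

/-!
# Route `BECThomsonPrinciple`, crux `DensityResponse` (stmt-AtomisticToContinuum-9481),
# line `force-balance-constitutive` — vocabulary and registered stub statements

`Defs` file of the crux line `force-balance-constitutive`
(`Summits/AtomisticToContinuum/BoseEinsteinCondensation/Cruxes/DensityResponse/Lines/force-balance-constitutive.{md,lean}`,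
idea card `…/Cruxes/DensityResponse/Ideas/force-balance-constitutive.md`, triage r1-1/2/3: pass; picked by the
lead, `…/Cruxes/DensityResponse/PICKED.md`). A `Cruxes/…/Lines/*.lean` skeleton is not an importable module, so the
objects the line posits and the STATEMENTS of its five registered stubs live here, to be imported verbatim by the
stub files `Theorems/BECThomsonPrincipleDensityResponse<Stub>.lean` (landed `--supports stmt-AtomisticToContinuum-9481`)
and by the closing composition. Contents:

* the line's vocabulary over existing declarations (`PeriodicTrialState`, `periodicEnergy`, `periodicInteraction`,
  `cellN`, `truncPotential`, `scatteringLength`): `kvec`, `ksq = |k|²`, `ksupSq = k∞²`, `phase`, `kDeriv = k·∇ᵢ`, the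
  signed density wave `sourceMean` (`m`, the crux's source integral without `|·|`), the effective number `effNumber`
  (`N_eff`), the kinetic stress wave `kineticStressWave` (`K_k`), the virial wave `virialWave` (`I_k`) and the stress
  wave `stressWave = K_k + (|k|²/4)m + I_k` — minus the first variations of `m`, of the interaction and of
  `periodicEnergy` along the flow of the displacement field `u_k(x) = k sin(k·x)/|k|²` acting on all bosons with the
  half-density Jacobian (`Φ^τ = e^{-τD}Φ`, `D = U·∇ + ½ div U`, `dE/dτ = -⟨[H,D]⟩ = -P_k`, `dm/dτ = -N_eff`;
  inner variations / hypervirial theorems: Hirschfelder, J. Chem. Phys. 33 (1960) 1462; Epstein–Hirschfelder,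
  Phys. Rev. 123 (1961) 1495; local momentum balance: Martin–Schwinger, Phys. Rev. 115 (1959) 1342);
* the predicates `CoreIneq`, `KinIneq` and the five stub statements `TransportStationary` (S1), `ConstitutiveCore`
  (S2, the open core held by the lead), `KineticSignCoherenceBounded` (S3a), `KineticSignCoherenceUnbounded` (S3b),
  `TruncationLimit` (S4; verbatim `Theorems.StaticResponseBound.Negative.UvThomsonStubs.TruncationLimit` of crux
  stmt-AtomisticToContinuum-12057 — one proof serves both lines) as named, deliberately untagged `Prop`s (statements
  of a proof plan, not results in print; the audit's advisory `vendored-fact` class is expected until the stub files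
  provide witnesses);
* elementary lemmas (`|m| ≤ 2N`, `0 ≤ N_eff ≤ 2N`, `k∞² ≤ |k|² ≤ 3k∞²`, window, truncation bookkeeping, Bochner
  normalisation) and the registered sub-goal `stub_kinIneqOfPos` — the `a > 0` half of S3a/S3b.

The kernel-checked composition `DensityResponse_of : S1 → S2 → S3a → S3b → S4 → BECThomsonPrinciple.DensityResponse`
stays in the registered skeleton and lands as `Theorems/BECThomsonPrincipleDensityResponse.lean` once the stubs close.
-/

namespace Summit.AtomisticToContinuum.BoseEinsteinCondensation.Cruxes.DensityResponse.ForceBalanceConstitutive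

open MeasureTheory
open scoped ENNReal
open Literature.MathematicalPhysics.QuantumManyBody.BoseGas

noncomputable section

/-! ### Vocabulary of the line (all over existing declarations) -/

section Vocabulary

variable {N : ℕ} {L : ℝ}

/-- The wave vector `k = (2π/L)·n ∈ ℝ³`. -/
def kvec (L : ℝ) (n : Fin 3 → ℤ) : Space := WithLp.toLp 2 fun j => 2 * Real.pi / L * (n j : ℝ)

/-- `q = |k|² = (2π/L)² ∑ⱼ nⱼ²` (Euclidean; the crux's denominator uses the sup norm `k∞² = ksupSq ≤ q ≤ 3 k∞²`). -/
def ksq (L : ℝ) (n : Fin 3 → ℤ) : ℝ := (2 * Real.pi / L) ^ 2 * ∑ j, (n j : ℝ) ^ 2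

/-- The crux's sup-norm wavenumber squared `k∞² = (2π‖n‖∞/L)²`. -/
def ksupSq (L : ℝ) (n : Fin 3 → ℤ) : ℝ := (2 * Real.pi * ‖(fun j => (n j : ℝ))‖ / L) ^ 2

/-- The phase `θᵢ(X) = k·xᵢ`. -/
def phase (L : ℝ) (n : Fin 3 → ℤ) (X : Config N) (i : Fin N) : ℝ :=
  2 * Real.pi / L * ∑ j, (n j : ℝ) * X i j

/-- `k·∇ᵢ g (X)`. -/
def kDeriv (L : ℝ) (n : Fin 3 → ℤ) (g : Config N → ℂ) (X : Config N) (i : Fin N) : ℂ :=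
  fderiv ℝ g X (Pi.single i (kvec L n))

/-- The (signed) DENSITY WAVE `m(Φ) = ∫_{cell^N} (∑ᵢ 2cos θᵢ)|Φ|²` — literally the crux's source integral
(without `|·|`, which is decoration: Disproof (h) `densityResponseNoAbs_iff`). -/
def sourceMean (n : Fin 3 → ℤ) (Φ : PeriodicTrialState N L) : ℝ :=
  ∫ X in cellN N L, (∑ i, 2 * Real.cos (2 * Real.pi / L * ∑ j, (n j : ℝ) * X i j)) * ‖Φ.ψ X‖ ^ 2

/-- `N_eff(Φ) = 2∫(∑ᵢ sin² θᵢ)|Φ|² ∈ [0, 2N]` — minus the first variation of `m` along the flow of `u_k`. -/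
def effNumber (n : Fin 3 → ℤ) (Φ : PeriodicTrialState N L) : ℝ :=
  ∫ X in cellN N L, (∑ i, 2 * Real.sin (phase L n X i) ^ 2) * ‖Φ.ψ X‖ ^ 2

/-- KINETIC STRESS WAVE `K_k(Φ) = 2∫ ∑ᵢ cos θᵢ |k̂·∇ᵢΦ|²` (modulated longitudinal kinetic energy). -/
def kineticStressWave (n : Fin 3 → ℤ) (Φ : PeriodicTrialState N L) : ℝ :=
  ∫ X in cellN N L, ∑ i, 2 * Real.cos (phase L n X i) * (‖kDeriv L n Φ.ψ X i‖ ^ 2 / ksq L n)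

/-- VIRIAL WAVE `I_k(Φ) = ∫ W(X)·∑ᵢ[cos θᵢ|Φ|² + (sin θᵢ/|k|²)·2Re(Φ̄ k·∇ᵢΦ)] dX = ∫ W div_X(|Φ|² U)`,
`W = ∑_{i<j} w^per(xᵢ-xⱼ)`, `U = (u_k(x₁),…,u_k(x_N))`: minus the first variation of the interaction along
the flow of `u_k` (for `w ∈ C¹` it is `-∫|Φ|²∑_{i<j}(u_k(xᵢ)-u_k(xⱼ))·∇w(xᵢ-xⱼ)`, the modulated virial; the
derivative sits on `|Φ|²`, so only measurability of `w` is used). -/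
def virialWave (w : ℝ → ℝ≥0∞) (n : Fin 3 → ℤ) (Φ : PeriodicTrialState N L) : ℝ :=
  ∫ X in cellN N L, (periodicInteraction w L X).toReal *
    ∑ i, (Real.cos (phase L n X i) * ‖Φ.ψ X‖ ^ 2
      + Real.sin (phase L n X i) / ksq L n * (2 * ((starRingEnd ℂ) (Φ.ψ X) * kDeriv L n Φ.ψ X i).re))

/-- STRESS WAVE `P_k(Φ) = K_k + (|k|²/4)·m + I_k` — minus the first variation of `periodicEnergy w` along
the flow of `u_k` (`(|k|²/4)m` is the kinetic energy of the half-density Jacobian factor). -/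
def stressWave (w : ℝ → ℝ≥0∞) (n : Fin 3 → ℤ) (Φ : PeriodicTrialState N L) : ℝ :=
  kineticStressWave n Φ + ksq L n / 4 * sourceMean n Φ + virialWave w n Φ

end Vocabulary

/-! ### The five stubs' statements (registered on stmt-AtomisticToContinuum-9481 by `ledger skeleton check`) -/

/-- **S1 — transport-stationarity normal form (size M–L).** For a BOUNDED admissible `w`, `L > 0`, a mode
`n ≠ 0`, a drive `s ≥ 0` and a finite-energy periodic state `Φ` there is a finite-energy state `Φ'` with no
larger driven energy than the better-signed translate of `Φ`, `E_w(Φ') - s·m(Φ') ≤ E_w(Φ) - s·|m(Φ)|`, which is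
TRANSPORT-STATIONARY: `P_k(Φ') = s·N_eff(Φ')`. Proof plan: half-wavelength translation
(`PeriodicTrialState.exists_translate`, `periodicEnergy_translate`) makes `m ≥ 0`, i.e. `m = |m|`; transport
`Φ^τ := (Φ∘F_{-τ})·Jac_τ^{1/2}` along the product flow `F_τ` of `U = (u_k(x₁),…,u_k(x_N))`,
`u_k(x) = k sin(k·x)/|k|²` (closed form `tan(θ/2) ↦ e^{τ}tan(θ/2)` per particle along `k̂`; smooth, `Lℤ³`-periodic,
commutes with permutations) stays in `PeriodicTrialState N L`; `τ ↦ E_w(Φ^τ)` and `τ ↦ m(Φ^τ)` are `C¹` (kinetic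
part in flattened variables `Y = F_{-τ}X`, where only `Φ, ∇Φ` enter; interaction with `τ` inside
`|Φ|²∘F_{-τ}·Jac_τ`, dominated differentiation for bounded `w`), `E_w(Φ^τ) → +∞` as `|τ| → ∞` (the flow squeezes
`|Φ|²` onto the attracting planes; Weizsäcker), so the minimum of `E_w - s·m` over `τ` is attained and its
derivative `-P_k + s·N_eff` vanishes there (`dE/dτ = -P_k`, `dm/dτ = -N_eff`: the commutator identities
`⟨[-Δ,D]⟩ = K_k + (|k|²/4)m`, `⟨[W,D]⟩ ↦ I_k`, `⟨[V_k,D]⟩ = N_eff` for `D = ∑ᵢ(u_k(xᵢ)·∇ᵢ + ½cos θᵢ)`, re-derived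
by triage r1-2 §E5; any positive multiple of `u_k` gives the same identity). FALSE at `n = 0` (Disproof (a)):
`n ≠ 0` is load-bearing here. Trivial for `N = 0` (`Φ' = Φ`, all waves vanish). -/
def TransportStationary : Prop :=
  ∀ (N : ℕ) (L : ℝ) (w : ℝ → ℝ≥0∞), IsRepulsiveFiniteRange w → (∃ B : ℝ, ∀ r, w r ≤ ENNReal.ofReal B) →
    0 < L → ∀ n : Fin 3 → ℤ, n ≠ 0 → ∀ s : ℝ, 0 ≤ s → ∀ Φ : PeriodicTrialState N L,
      periodicEnergy w Φ ≠ ⊤ →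
      ∃ Φ' : PeriodicTrialState N L, periodicEnergy w Φ' ≠ ⊤ ∧
        (periodicEnergy w Φ').toReal - s * sourceMean n Φ' ≤
            (periodicEnergy w Φ).toReal - s * |sourceMean n Φ| ∧
        stressWave w n Φ' = s * effNumber n Φ'

/-- The CONSTITUTIVE INEQUALITY for the potential `w` at scattering-length parameter `a`, window `M`, constants
`ρ₀, κ, C₁, N₀`: for `N ≥ N₀`, `L > 0`, `N ≤ ρ₀L³`, every mode `k = 2πn/L ≠ 0` with `|k| ≤ M√ρ`, every drive
`0 ≤ s ≤ ρ·a` and every finite-energy state `Φ` that is transport-stationary for `w` (`P_k = s N_eff`), sub-ground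
(`E_w(Φ) - s m(Φ) ≤ E₀(w,N,L)`) and positively modulated (`m(Φ) ≥ 0`):
`κ·ρa·m(Φ) ≤ K_k(Φ) + I_k(Φ) + C₁·s·N` (stress–virial wave ≥ half the inverse compressibility × density wave). -/
def CoreIneq (w : ℝ → ℝ≥0∞) (a M ρ₀ κ C₁ : ℝ) (N₀ : ℕ) : Prop :=
  ∀ N : ℕ, N₀ ≤ N → ∀ L : ℝ, 0 < L → (N : ℝ) ≤ ρ₀ * L ^ 3 → ∀ n : Fin 3 → ℤ, n ≠ 0 →
    2 * Real.pi * ‖(fun j => (n j : ℝ))‖ / L ≤ M * Real.sqrt (N / L ^ 3) →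
    ∀ s : ℝ, 0 ≤ s → s ≤ N / L ^ 3 * a →
    ∀ Φ : PeriodicTrialState N L, periodicEnergy w Φ ≠ ⊤ →
      stressWave w n Φ = s * effNumber n Φ →
      (periodicEnergy w Φ).toReal - s * sourceMean n Φ ≤ (periodicGroundStateEnergy w N L).toReal →
      0 ≤ sourceMean n Φ →
        κ * (N / L ^ 3 * a) * sourceMean n Φ ≤ kineticStressWave n Φ + virialWave w n Φ + C₁ * s * N

/-- KINETIC SIGN-COHERENCE for the potential `w` at scattering-length parameter `a`, window `M`, constants
`ρ₀, C', N₀`: as `CoreIneq` but for drives `s ≥ ρ·a` and with no sign condition on `m`: the stress–virial wave of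
a finite-energy transport-stationary sub-ground state is not anti-phased with the drive beyond a multiple of it,
`-C'·s·N ≤ K_k(Φ) + I_k(Φ)` (by stationarity: `m ≤ 4(2+C')sN/|k|²`). -/
def KinIneq (w : ℝ → ℝ≥0∞) (a M ρ₀ C' : ℝ) (N₀ : ℕ) : Prop :=
  ∀ N : ℕ, N₀ ≤ N → ∀ L : ℝ, 0 < L → (N : ℝ) ≤ ρ₀ * L ^ 3 → ∀ n : Fin 3 → ℤ, n ≠ 0 →
    2 * Real.pi * ‖(fun j => (n j : ℝ))‖ / L ≤ M * Real.sqrt (N / L ^ 3) →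
    ∀ s : ℝ, 0 ≤ s → N / L ^ 3 * a ≤ s →
    ∀ Φ : PeriodicTrialState N L, periodicEnergy w Φ ≠ ⊤ →
      stressWave w n Φ = s * effNumber n Φ →
      (periodicEnergy w Φ).toReal - s * sourceMean n Φ ≤ (periodicGroundStateEnergy w N L).toReal →
        -(C' * s * N) ≤ kineticStressWave n Φ + virialWave w n Φ

/-- **S2 — the constitutive core `C⁺` in the sub-healing drive window (THE OPEN CORE; XL).** For every
admissible envelope `v` (hard cores allowed) and window `M` there are `ρ₀, κ, C₁ > 0`, `N₀` and a truncation
height `t₀` such that `CoreIneq` holds, uniformly in `t ≥ t₀`, for the bounded truncation `v_t = min(v, t)`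
(`truncPotential`) with the scattering length `a(v)` of the ENVELOPE (for `t ≥ t₀` large `a(v_t) ≥ a(v)/2`;
`a(v) ≤ R₀ < ∞` for finite range, LSSY App. C Rem. 2). For bounded `v` and `t ≥ sup v` (`v_t = v`) this is
verbatim the card's `ConstitutiveInequality` restricted to `s ≤ ρa`; by the stationarity identity it is
EQUIVALENT there to the crux's linear-response content `m ≤ 4(2+C₁)sN/(|k|² + 4κρa)` (triage r1-1 App. F(i)) —
not weaker, but `E₀(v)` has left the conclusion (it only selects the class), both sides are FIRST order in the
modulation (an additive error `εNρa` costs `δ/ρ ≳ ε`, not `√ε`), and after splitting off the explicit Born piece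
`(ρw(k)/2)·m ≥ 0` what must be bounded below is the pair-sector observable `X_corr` (card item (4)).
Bogoliubov: `K_k + I_k = 4πρa·m` exactly at every `k` (`κ = 4π`, `C₁ = 0`); free gas / `a = 0`: the window is
`s = 0`, the class is `{Ψ₀}` and both sides vanish. Why it might fail: anomalously soft low-`k` density weight of
transport-stationary near-minimisers in the thermodynamic box (the item's why-might-fail, untouched: the card's
LDA accounting reaches `s ≳ ρa(ρa³)^{1/2}` only); for hard-core envelopes the constants must moreover be uniform in
the truncation height. -/
def ConstitutiveCore : Prop :=
  ∀ v : ℝ → ℝ≥0∞, IsRepulsiveFiniteRange v → ∀ M : ℝ, 0 < M →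
    ∃ ρ₀ κ C₁ : ℝ, 0 < ρ₀ ∧ 0 < κ ∧ 0 < C₁ ∧ ∃ N₀ t₀ : ℕ, ∀ t : ℕ, t₀ ≤ t →
      CoreIneq (truncPotential v t) (scatteringLength v).toReal M ρ₀ κ C₁ N₀

/-- **S3a — kinetic sign-coherence at super-healing drives, BOUNDED potentials (M–L; the card's item (3b), the
line's first landable piece).** For a bounded admissible `v` and window `M`: `KinIneq v a(v) M ρ₀ C' N₀` for some
`ρ₀, C' > 0, N₀`. Proof plan: `|K_k| ≤ 2T(Φ) ≤ 2E(Φ)`; the INTEGRATED virial domination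
`|I_k(Φ)| ≤ K_v E(Φ) + K'_v ρa N` on sub-ground states (triage r1-2/3: the pointwise "tame v" class is empty — prove
it as a trace/kinetic trade-off in the pair coordinate, `K_v = K(‖v‖∞, R)`; for a step `V₀𝟙_{r<R}` the virial wave is
`V₀` times a trace of `|Φ|²(uᵢ-uⱼ)·r̂` on the contact spheres); `E(Φ) ≤ E₀ + s·m ≤ E₀ + 2sN` (`|m| ≤ 2N`); Dyson's
upper bound `E₀ ≤ 4πρ₁a(1 + C a/b)N` (PROVED in tree: `LSSY2005_upperBound_periodic_holds`, needs `2R₀ < L`,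
`N ≥ 2`, `a/b ≤ c` — choose `ρ₀`, `N₀`); with `ρa ≤ s`: `C' = (2+K_v)(4π(1+c') + 2) + K'_v`. No smallness of `s`
and no sign of `m` is needed. Why it might fail: only through the virial-domination lemma (a state with finite
energy but a large contact trace) — the constants may depend on `v`, so this is a robustness, not a depth, issue.
Fails in `d = 1` at `k → 2k_F` (Tonks–Lindhard log), correctly outside any dilute window. -/
def KineticSignCoherenceBounded : Prop :=
  ∀ v : ℝ → ℝ≥0∞, IsRepulsiveFiniteRange v → (∃ B : ℝ, ∀ r, v r ≤ ENNReal.ofReal B) → ∀ M : ℝ, 0 < M →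
    ∃ ρ₀ C' : ℝ, 0 < ρ₀ ∧ 0 < C' ∧ ∃ N₀ : ℕ, KinIneq v (scatteringLength v).toReal M ρ₀ C' N₀

/-- **S3b — kinetic sign-coherence at super-healing drives, UNBOUNDED potentials (hard cores; L–XL).** For an
unbounded admissible `v` (hard core, or singular repulsion) and window `M`: `KinIneq (v_t) a(v) M ρ₀ C' N₀`
uniformly in the truncation height `t ≥ t₀`. The bounded-case argument gives `t`-dependent constants
(`K_{v_t} → ∞`); truncation-UNIFORM ones need the contact form of the virial wave: as `t → ∞`,
`I_k(Φ) → V`-independent contact term (`t·|Φ|²` at the core boundary stays `O(1)` for sub-ground states: penetration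
depth `t^{-1/2}`, i.e. the virial theorem for hard spheres), to be dominated by `E(Φ) + ρaN` uniformly in `t` — an
additive `O(sN)` error is affordable here since `s ≥ ρa`. Open but strictly smaller than the crux (large drives
only); the route's other cruxes exclude hard cores outright (FibreConductance), this line isolates them here. -/
def KineticSignCoherenceUnbounded : Prop :=
  ∀ v : ℝ → ℝ≥0∞, IsRepulsiveFiniteRange v → (∀ B : ℝ, ∃ r, ENNReal.ofReal B < v r) → ∀ M : ℝ, 0 < M →
    ∃ ρ₀ C' : ℝ, 0 < ρ₀ ∧ 0 < C' ∧ ∃ N₀ t₀ : ℕ, ∀ t : ℕ, t₀ ≤ t →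
      KinIneq (truncPotential v t) (scatteringLength v).toReal M ρ₀ C' N₀

/-- **S4 — truncation limit at fixed volume (M–L; VERBATIM the sibling stub `TruncationLimit` of
`Cruxes/StaticResponseBound/Lines/uv-thomson-force-wave.lean` — one proof serves both lines).** At FIXED `(N, L)`
the periodic ground-state energies of the truncations `v_t = min(v,t)` converge up to that of `v` whenever the
latter is finite: `∀ ε > 0 ∃ t₁ ∀ t ≥ t₁, E₀^per(v,N,L) ≤ E₀^per(v_t,N,L) + ε` (the other inequality is
monotonicity). Why true: near-minimisers of `v_t` are bounded in `H¹` of the torus, converge (Rellich) to `Ψ ∈ H¹`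
with `∫|∇Ψ|² + ∫v_m|Ψ|² ≤ lim E₀(v_t)` for every `m` (lower semicontinuity), hence `Ψ = 0` a.e. on the core set and
`E_v[Ψ] ≤ lim E₀(v_t)` (monotone convergence); `E₀^per(v) ≤ E_v[Ψ]` by `C¹` approximation in the form norm off the
core set (B. Simon, J. Funct. Anal. 28 (1978) 377; Adams–Hedberg Thm 9.1.3). Trivial for bounded `v`. Used ONLY to
transfer ground-state ENERGIES from `v_t` to `v` (transport moves hard cores, so S1 is run on `v_t`, never on `v`). -/
def TruncationLimit : Prop :=
  ∀ v : ℝ → ℝ≥0∞, IsRepulsiveFiniteRange v → ∀ (N : ℕ) (L : ℝ), 0 < L →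
    periodicGroundStateEnergy v N L ≠ ⊤ →
    ∀ ε : ℝ, 0 < ε → ∃ n₁ : ℕ, ∀ n : ℕ, n₁ ≤ n →
      (periodicGroundStateEnergy v N L).toReal ≤
        (periodicGroundStateEnergy (truncPotential v n) N L).toReal + ε

/-! ### Elementary lemmas (used by the composition and by the stub files) -/

section Lemmas

variable {N : ℕ} {L : ℝ}

/-- The truncation `v_t = min(v, t)` of an admissible potential is admissible (same range). [folklore] -/
theorem isRepulsiveFiniteRange_truncPotential {v : ℝ → ℝ≥0∞} (hv : IsRepulsiveFiniteRange v) (t : ℕ) :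
    IsRepulsiveFiniteRange (truncPotential v t) := by
  refine ⟨measurable_truncPotential hv.1 t, ?_⟩
  obtain ⟨R₀, hR₀⟩ := hv.2
  exact ⟨R₀, fun r hr => truncPotential_eq_zero (hR₀ r hr) t⟩

/-- A bounded potential is its own truncation beyond its height. [folklore] -/
theorem truncPotential_eq_self_of_le {v : ℝ → ℝ≥0∞} {B : ℝ} (hB : ∀ r, v r ≤ ENNReal.ofReal B) {t : ℕ}
    (ht : B ≤ t) : truncPotential v t = v := by
  funext r
  unfold truncPotential
  refine min_eq_left ((hB r).trans ?_)
  rw [← ENNReal.ofReal_natCast]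
  exact ENNReal.ofReal_le_ofReal ht

/-- Monotonicity of the periodic energy under truncation of the potential. [folklore] -/
theorem periodicEnergy_truncPotential_le (v : ℝ → ℝ≥0∞) (t : ℕ) (Ψ : PeriodicTrialState N L) :
    periodicEnergy (truncPotential v t) Ψ ≤ periodicEnergy v Ψ := by
  unfold periodicEnergy
  refine lintegral_mono fun X => ?_
  refine add_le_add le_rfl (mul_le_mul_left ?_ _)
  unfold periodicInteraction
  refine Finset.sum_le_sum fun i _ => Finset.sum_le_sum fun j _ => ?_
  unfold periodizedPotential
  exact ENNReal.tsum_le_tsum fun m => truncPotential_le v t _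

/-- The Bochner normalisation of an admissible state: `∫_{cell^N} |Ψ|² = 1`. [folklore] -/
theorem integral_norm_sq_eq_one (Ψ : PeriodicTrialState N L) :
    ∫ X in cellN N L, ‖Ψ.ψ X‖ ^ 2 = 1 := by
  have hint : Integrable (fun X => ‖Ψ.ψ X‖ ^ 2) (volume.restrict (cellN N L)) :=
    integrableOn_cellN ((Ψ.contDiff.continuous.norm).pow 2) L
  have h := ofReal_integral_eq_lintegral_ofReal hint
    (Filter.Eventually.of_forall fun X => sq_nonneg _)
  simp_rw [← coe_nnnorm_sq_eq_ofReal] at h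
  rw [Ψ.norm_eq] at h
  have hnn : 0 ≤ ∫ X in cellN N L, ‖Ψ.ψ X‖ ^ 2 := integral_nonneg fun X => sq_nonneg _
  have := congrArg ENNReal.toReal h
  rwa [ENNReal.toReal_ofReal hnn, ENNReal.toReal_one] at this

/-- A bounded continuous weight integrated against `|Ψ|² dX` on the cell is bounded by its bound. [folklore] -/
theorem abs_integral_mul_norm_sq_le (Ψ : PeriodicTrialState N L) {g : Config N → ℝ} (hg : Continuous g)
    {G : ℝ} (hG : ∀ X, |g X| ≤ G) : |∫ X in cellN N L, g X * ‖Ψ.ψ X‖ ^ 2| ≤ G := by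
  have hψc : Continuous fun X => ‖Ψ.ψ X‖ ^ 2 := (Ψ.contDiff.continuous.norm).pow 2
  have hi : IntegrableOn (fun X => g X * ‖Ψ.ψ X‖ ^ 2) (cellN N L) volume :=
    integrableOn_cellN (hg.mul hψc) L
  have hi2 : IntegrableOn (fun X => G * ‖Ψ.ψ X‖ ^ 2) (cellN N L) volume :=
    integrableOn_cellN (continuous_const.mul hψc) L
  calc |∫ X in cellN N L, g X * ‖Ψ.ψ X‖ ^ 2|
      ≤ ∫ X in cellN N L, |g X * ‖Ψ.ψ X‖ ^ 2| := abs_integral_le_integral_abs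
    _ ≤ ∫ X in cellN N L, G * ‖Ψ.ψ X‖ ^ 2 := by
        refine integral_mono hi.abs hi2 fun X => ?_
        show |g X * ‖Ψ.ψ X‖ ^ 2| ≤ G * ‖Ψ.ψ X‖ ^ 2
        rw [abs_mul, abs_of_nonneg (sq_nonneg ‖Ψ.ψ X‖)]
        exact mul_le_mul_of_nonneg_right (hG X) (sq_nonneg _)
    _ = G := by rw [integral_const_mul, integral_norm_sq_eq_one, mul_one]

/-- The phase of particle `i` is continuous in the configuration. [folklore] -/
theorem continuous_phase (L : ℝ) (n : Fin 3 → ℤ) (i : Fin N) :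
    Continuous fun X : Config N => phase L n X i := by
  unfold phase
  refine continuous_const.mul (continuous_finsetSum _ fun j _ => continuous_const.mul ?_)
  fun_prop

/-- `|m(Φ)| ≤ 2N` (Disproof (g) `abs_source_le`, re-proved). [folklore] -/
theorem abs_sourceMean_le (n : Fin 3 → ℤ) (Φ : PeriodicTrialState N L) : |sourceMean n Φ| ≤ 2 * N := by
  unfold sourceMean
  refine abs_integral_mul_norm_sq_le Φ ?_ fun X => ?_
  · refine continuous_finsetSum _ fun i _ => continuous_const.mul (Real.continuous_cos.comp ?_)
    exact continuous_phase L n i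
  · calc |∑ i : Fin N, 2 * Real.cos (2 * Real.pi / L * ∑ j, (n j : ℝ) * X i j)|
        ≤ ∑ i : Fin N, |2 * Real.cos (2 * Real.pi / L * ∑ j, (n j : ℝ) * X i j)| :=
          Finset.abs_sum_le_sum_abs _ _
      _ ≤ ∑ _i : Fin N, (2 : ℝ) := Finset.sum_le_sum fun i _ => by
          rw [abs_mul, abs_of_pos (by norm_num : (0 : ℝ) < 2)]
          nlinarith [Real.abs_cos_le_one (2 * Real.pi / L * ∑ j, (n j : ℝ) * X i j)]
      _ = 2 * N := by
          rw [Finset.sum_const, Finset.card_univ, Fintype.card_fin, nsmul_eq_mul, mul_comm]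

/-- `N_eff(Φ) ≤ 2N`. [folklore] -/
theorem effNumber_le (n : Fin 3 → ℤ) (Φ : PeriodicTrialState N L) : effNumber n Φ ≤ 2 * N := by
  unfold effNumber
  refine (le_abs_self _).trans (abs_integral_mul_norm_sq_le Φ ?_ fun X => ?_)
  · exact continuous_finsetSum _ fun i _ =>
      continuous_const.mul ((Real.continuous_sin.comp (continuous_phase L n i)).pow 2)
  · rw [abs_of_nonneg (Finset.sum_nonneg fun i _ => by positivity)]
    calc ∑ i : Fin N, 2 * Real.sin (phase L n X i) ^ 2
        ≤ ∑ _i : Fin N, (2 : ℝ) := Finset.sum_le_sum fun i _ => by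
          nlinarith [Real.sin_sq_le_one (phase L n X i)]
      _ = 2 * N := by
          rw [Finset.sum_const, Finset.card_univ, Fintype.card_fin, nsmul_eq_mul, mul_comm]

/-- `k∞² ≤ |k|²` (sup norm versus Euclidean norm of the mode). [folklore] -/
theorem ksupSq_le_ksq (L : ℝ) (n : Fin 3 → ℤ) : ksupSq L n ≤ ksq L n := by
  unfold ksupSq ksq
  have hsum : 0 ≤ ∑ j, (n j : ℝ) ^ 2 := Finset.sum_nonneg fun j _ => sq_nonneg _
  have hnorm : ‖(fun j => (n j : ℝ))‖ ≤ Real.sqrt (∑ j, (n j : ℝ) ^ 2) := by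
    refine (pi_norm_le_iff_of_nonneg (Real.sqrt_nonneg _)).2 fun i => ?_
    rw [Real.norm_eq_abs]
    exact Real.abs_le_sqrt
      (Finset.single_le_sum (f := fun j => (n j : ℝ) ^ 2) (fun j _ => sq_nonneg _) (Finset.mem_univ i))
  have h0 : 0 ≤ ‖(fun j => (n j : ℝ))‖ := norm_nonneg _
  have hsq : ‖(fun j => (n j : ℝ))‖ ^ 2 ≤ ∑ j, (n j : ℝ) ^ 2 := by
    calc ‖(fun j => (n j : ℝ))‖ ^ 2 ≤ Real.sqrt (∑ j, (n j : ℝ) ^ 2) ^ 2 := pow_le_pow_left₀ h0 hnorm 2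
      _ = ∑ j, (n j : ℝ) ^ 2 := Real.sq_sqrt hsum
  have : (2 * Real.pi * ‖(fun j => (n j : ℝ))‖ / L) ^ 2 =
      (2 * Real.pi / L) ^ 2 * ‖(fun j => (n j : ℝ))‖ ^ 2 := by ring
  rw [this]
  exact mul_le_mul_of_nonneg_left hsq (sq_nonneg _)

/-- `0 ≤ N_eff(Φ)`. [folklore] -/
theorem effNumber_nonneg (n : Fin 3 → ℤ) (Φ : PeriodicTrialState N L) : 0 ≤ effNumber n Φ := by
  unfold effNumber
  exact integral_nonneg fun X => mul_nonneg (Finset.sum_nonneg fun i _ => by positivity) (sq_nonneg _)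

/-- `|k|² ≤ 3 k∞²` (Euclidean versus sup norm of the mode). [folklore] -/
theorem ksq_le_three_mul_ksupSq (L : ℝ) (n : Fin 3 → ℤ) : ksq L n ≤ 3 * ksupSq L n := by
  unfold ksq ksupSq
  have h : ∀ j, (n j : ℝ) ^ 2 ≤ ‖(fun j => (n j : ℝ))‖ ^ 2 := fun j => by
    rw [← sq_abs, ← Real.norm_eq_abs]
    exact pow_le_pow_left₀ (norm_nonneg _) (norm_le_pi_norm (fun j => (n j : ℝ)) j) 2
  have hsum : ∑ j, (n j : ℝ) ^ 2 ≤ 3 * ‖(fun j => (n j : ℝ))‖ ^ 2 := by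
    calc ∑ j, (n j : ℝ) ^ 2 ≤ ∑ _j : Fin 3, ‖(fun j => (n j : ℝ))‖ ^ 2 := Finset.sum_le_sum fun j _ => h j
      _ = 3 * ‖(fun j => (n j : ℝ))‖ ^ 2 := by
          rw [Finset.sum_const, Finset.card_univ, Fintype.card_fin, nsmul_eq_mul, Nat.cast_ofNat]
  have : 3 * (2 * Real.pi * ‖(fun j => (n j : ℝ))‖ / L) ^ 2 =
      (2 * Real.pi / L) ^ 2 * (3 * ‖(fun j => (n j : ℝ))‖ ^ 2) := by ring
  rw [this]
  exact mul_le_mul_of_nonneg_left hsum (sq_nonneg _)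

/-- The window `k∞ ≤ M√ρ` squared: `k∞² ≤ M² ρ` (for `L > 0`). [folklore] -/
theorem ksupSq_le_of_window {L : ℝ} (hL : 0 < L) {M ρ : ℝ} (hρ : 0 ≤ ρ) {n : Fin 3 → ℤ}
    (hwin : 2 * Real.pi * ‖(fun j => (n j : ℝ))‖ / L ≤ M * Real.sqrt ρ) : ksupSq L n ≤ M ^ 2 * ρ := by
  unfold ksupSq
  have h0 : 0 ≤ 2 * Real.pi * ‖(fun j => (n j : ℝ))‖ / L := by positivity
  calc (2 * Real.pi * ‖(fun j => (n j : ℝ))‖ / L) ^ 2 ≤ (M * Real.sqrt ρ) ^ 2 := pow_le_pow_left₀ h0 hwin 2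
    _ = M ^ 2 * ρ := by rw [mul_pow, Real.sq_sqrt hρ]

/-! ### The `a > 0` half of kinetic sign-coherence (registered sub-goal, shared by S3a and S3b) -/

/-- **Kinetic sign-coherence at super-healing drives, for ANY potential `w`, whenever the scattering-length
parameter is positive**: `KinIneq w a M ρ₀ (3M²/(2a)) N₀` for `a > 0`, `M > 0` and arbitrary `ρ₀`, `N₀`. Reading the
registered predicate literally, no virial domination is needed: transport-stationarity gives
`K_k + I_k = s·N_eff − (|k|²/4)·m` with `N_eff ≥ 0`, and `(|k|²/4)·m ≤ (3k∞²/4)·2N ≤ (3M²ρ/2)·N ≤ (3M²/(2a))·s·N` by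
`|m| ≤ 2N`, `|k|² ≤ 3k∞²`, the window `k∞² ≤ M²ρ` and the drive floor `ρa ≤ s`. (For `a > 0` the whole strip
`s ≥ ρa` of the crux is thus trivial inside the window, cf. Disproof (g) `chord_trivial_large_s`.) [folklore] -/
theorem stub_kinIneqOfPos : ∀ (w : ℝ → ℝ≥0∞) (a M ρ₀ : ℝ) (N₀ : ℕ), 0 < a → 0 < M →
    KinIneq w a M ρ₀ (3 * M ^ 2 / (2 * a)) N₀ := by
  intro w a M ρ₀ N₀ ha hM N _ L hL _ n _ hwin s hs hρa Φ _ hstat _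
  have hρ : 0 ≤ (N : ℝ) / L ^ 3 := by positivity
  have hksq0 : 0 ≤ ksq L n := by unfold ksq; positivity
  have hk : ksq L n ≤ 3 * (M ^ 2 * ((N : ℝ) / L ^ 3)) :=
    (ksq_le_three_mul_ksupSq L n).trans (mul_le_mul_of_nonneg_left (ksupSq_le_of_window hL hρ hwin) (by norm_num))
  have hm : sourceMean n Φ ≤ 2 * N := (le_abs_self _).trans (abs_sourceMean_le n Φ)
  have hNeff : 0 ≤ s * effNumber n Φ := mul_nonneg hs (effNumber_nonneg n Φ)
  have hρs : M ^ 2 * ((N : ℝ) / L ^ 3) ≤ M ^ 2 * (s / a) := by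
    refine mul_le_mul_of_nonneg_left ?_ (sq_nonneg M)
    rw [le_div_iff₀ ha]; exact hρa
  have hKI : kineticStressWave n Φ + virialWave w n Φ = s * effNumber n Φ - ksq L n / 4 * sourceMean n Φ := by
    unfold stressWave at hstat; linarith
  have h1 : ksq L n / 4 * sourceMean n Φ ≤ ksq L n / 4 * (2 * N) :=
    mul_le_mul_of_nonneg_left hm (by positivity)
  have h2 : ksq L n / 4 * (2 * (N : ℝ)) ≤ 3 * (M ^ 2 * (s / a)) / 4 * (2 * N) :=
    mul_le_mul_of_nonneg_right (by linarith) (by positivity)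
  have h3 : 3 * (M ^ 2 * (s / a)) / 4 * (2 * (N : ℝ)) = 3 * M ^ 2 / (2 * a) * s * N := by
    field_simp
    ring
  rw [hKI]
  linarith

end Lemmas

end

end Summit.AtomisticToContinuum.BoseEinsteinCondensation.Cruxes.DensityResponse.ForceBalanceConstitutive
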